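import Summits.CriticalPhenomena.Ising3DConformalLimit.Theses.FKParityRobustness
import Summits.CriticalPhenomena.Ising3DConformalLimit.Theorems.FKParityRobustnessDefs
import Literature.Probability.LatticeModels.LoopO1
import Literature.Probability.LatticeModels.RandomCluster
import HarnessLib

/-!
# The sourced Grimmett–Janson identity: stub `stub_grimmettJanson` of line
# `plaquette-xor-surgery` for crux `ParityRobustMerging` (stmt-CriticalPhenomena-11253)

Route `FKParityRobustness`.  For a finite graph `G = (V, E)`, `p ∈ [0, 1]`, a source set `A ⊆ V`
and an arbitrary predicate `P` on edge sets, write `𝒯_A(ω) = tJoins G ω A` for the `T`-joins of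
`A` inside `ω` (edge sets `F ⊆ ω ∩ E` with odd degree exactly on `A`), `𝓔_∅(ω) = evenSubgraphs G ω`
for the even subgraphs of `ω`, `k(ω) = clusterCount ω ∅` for the number of open clusters and
`w_{p,2}(ω) = p^{|ω|} (1 − p)^{|E ∖ ω|} 2^{k(ω)} = rcWeight G p 2 ∅ ω` for the free `q = 2`
random-cluster weight.  GIVEN the cycle-space count `#𝓔_∅(ω) · 2^{|V|} = 2^{|ω| + k(ω)}` for every
`ω ⊆ E` (the neighbouring stub `stub_evenSubgraphCount`, taken here as a hypothesis), we prove the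
exact finite-sum form of the sourced Grimmett–Janson coupling

  `∑_{ω ⊆ E} w_{p,2}(ω) · #{F ∈ 𝒯_A(ω) : P F} / #𝓔_∅(ω)`
  `  = 2^{|V|} (1 − p/2)^{|E|} · ∑_{F ∈ 𝒯_A(E), P F} (p / (2 − p))^{|F|}`,

i.e. a uniformly chosen `T`-join of a `φ_{p,2}`-distributed configuration is loop-O(1) distributed
at `t = p/(2 − p)` (Grimmett–Janson 2009, Thm. 3.1 for `A = ∅`; Hansen–Jiang–Klausen 2025, §2).

Proof (finite sums only).  (1) `#{F ∈ 𝒯_A(ω) : P F} = #{F ∈ 𝒯_A(E) : P F, F ⊆ ω}`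
(`filter_tJoins_coe`).  (2) By the count,
`w_{p,2}(ω) / #𝓔_∅(ω) = 2^{|V|} (p/2)^{|ω|} (1 − p)^{|E ∖ ω|}`
(`rcWeight_two_div_card_evenSubgraphs`; no division by `1 − p`).  (3) Swap the two sums
(`Finset.sum_comm'`) and, for fixed `F ⊆ E`, resum over the supersets of `F`:
`∑_{F ⊆ ω ⊆ E} a^{|ω|} b^{|E ∖ ω|} = a^{|F|} (a + b)^{|E| − |F|}` (`sum_superset_pow_mul_pow`, the
binomial theorem `Finset.sum_pow_mul_eq_add_pow` on `E ∖ F` after `ω = F ∪ S`).  (4) With `a = p/2`,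
`b = 1 − p`: `(p/2)^{|F|} (1 − p/2)^{|E| − |F|} = (1 − p/2)^{|E|} (p/(2 − p))^{|F|}` since
`1 − p/2 ≥ 1/2 > 0`.

* `sum_superset_pow_mul_pow` — the superset resummation (3);
* `tJoins_coe_eq_filter`, `filter_tJoins_coe` — step (1);
* `rcWeight_two_div_card_evenSubgraphs` — step (2);
* `grimmettJanson_identity` — the identity on one finite graph, from the count on that graph;
* `stub_grimmettJanson` — the registered stub, verbatim.

Theorem-only file (no new definitions); Mathlib + the tree's `LoopO1` and `RandomCluster`.
References: G. Grimmett, S. Janson, *Random even graphs*, Electron. J. Combin. 16 (2009),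
arXiv:0709.3039, Thm. 3.1 [GrimmettJanson2007]; U. T. Hansen, J. Jiang, F. R. Klausen, *A general
coupling for Ising models and beyond*, arXiv:2506.10765, §2 [HansenJiangKlausen2025]; G. Grimmett,
*Probability on Graphs*, 2nd ed. (2018), Thm. 8.65–8.66.
-/

noncomputable section

open MeasureTheory Finset
open Literature.Probability.LatticeModels

namespace Summit.CriticalPhenomena.Ising3DConformalLimit.Cruxes.ParityRobustMerging.PlaquetteXorSurgery

open scoped Classical

section General

/-- **Binomial resummation over supersets** [folklore]: for `F ⊆ E` and real `a, b`,
`∑_{F ⊆ ω ⊆ E} a^{|ω|} b^{|E ∖ ω|} = a^{|F|} (a + b)^{|E| − |F|}`.  Substitute `ω = F ∪ S` with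
`S ⊆ E ∖ F` (a bijection, inverse `ω ↦ ω ∖ F`) and apply the binomial theorem
`Finset.sum_pow_mul_eq_add_pow` on `E ∖ F`. -/
theorem sum_superset_pow_mul_pow {α : Type*} [DecidableEq α] {E F : Finset α} (hF : F ⊆ E)
    (a b : ℝ) :
    ∑ ω ∈ E.powerset.filter (fun ω => F ⊆ ω), a ^ #ω * b ^ #(E \ ω) =
      a ^ #F * (a + b) ^ (#E - #F) := by
  -- adapted from the prior stockroom lemma `NpmXorAnd.sum_supersets` (reserve/prior-2001)
  rw [← card_sdiff_of_subset hF, ← Finset.sum_pow_mul_eq_add_pow, Finset.mul_sum]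
  refine Finset.sum_nbij' (fun ω => ω \ F) (fun S => F ∪ S) ?_ ?_ ?_ ?_ ?_
  · intro ω hω
    rw [mem_filter, mem_powerset] at hω
    exact mem_powerset.2 (sdiff_subset_sdiff hω.1 subset_rfl)
  · intro S hS
    rw [mem_powerset] at hS
    exact mem_filter.2 ⟨mem_powerset.2 (union_subset hF (hS.trans sdiff_subset)),
      subset_union_left⟩
  · intro ω hω
    rw [mem_filter] at hω
    exact union_sdiff_of_subset hω.2
  · intro S hS
    rw [mem_powerset] at hS
    exact union_sdiff_cancel_left (disjoint_sdiff.mono_right hS)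
  · intro ω hω
    rw [mem_filter, mem_powerset] at hω
    have h1 : #(ω \ F) = #ω - #F := card_sdiff_of_subset hω.2
    have h2 : #(E \ F) = #E - #F := card_sdiff_of_subset hF
    have h3 : #(E \ ω) = #E - #ω := card_sdiff_of_subset hω.1
    have h4 : #F ≤ #ω := card_le_card hω.2
    have h5 : #ω ≤ #E := card_le_card hω.1
    have e1 : #F + #(ω \ F) = #ω := by omega
    have e2 : #(E \ F) - #(ω \ F) = #(E \ ω) := by omega
    rw [← mul_assoc, ← pow_add, e1, e2]

variable {V : Type*} [Fintype V] [DecidableEq V] (G : SimpleGraph V) [DecidableRel G.Adj]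

/-- The `T`-joins of `A` inside the edge set `ω` are the `T`-joins of `A` in `G` contained in `ω`:
`𝒯_A(ω) = {F ∈ 𝒯_A(E(G)) : F ⊆ ω}` [folklore] (unfolding of `tJoins`, `Finset.coe_subset`). -/
theorem tJoins_coe_eq_filter (ω : Finset (Sym2 V)) (A : Finset V) :
    tJoins G (↑ω : Set (Sym2 V)) A = (tJoins G Set.univ A).filter (fun F => F ⊆ ω) := by
  ext F
  simp only [Finset.mem_filter, mem_tJoins, Set.subset_univ, true_and, Finset.coe_subset]
  tauto

/-- Step (1) of the Grimmett–Janson computation [folklore]: the `T`-joins of `A` inside `ω`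
satisfying `P` are the `T`-joins of `A` in `G` satisfying `P` and contained in `ω`, so that
`#{F ∈ 𝒯_A(ω) : P F} = ∑_{F ∈ 𝒯_A(E), P F} 1[F ⊆ ω]`. -/
theorem filter_tJoins_coe (ω : Finset (Sym2 V)) (A : Finset V) (P : Finset (Sym2 V) → Prop)
    [DecidablePred P] :
    (tJoins G (↑ω : Set (Sym2 V)) A).filter (fun F => P F) =
      ((tJoins G Set.univ A).filter (fun F => P F)).filter (fun F => F ⊆ ω) := by
  rw [tJoins_coe_eq_filter, Finset.filter_comm]

/-- Step (2) of the Grimmett–Janson computation [cite: GrimmettJanson2007, Thm 3.1]: if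
`#𝓔_∅(ω) · 2^{|V|} = 2^{|ω| + k(ω)}` (the cycle-space count of `ω`), then the free `q = 2`
random-cluster weight per even subgraph is a Bernoulli-type weight,
`w_{p,2}(ω) / #𝓔_∅(ω) = 2^{|V|} · (p/2)^{|ω|} (1 − p)^{|E ∖ ω|}` — the factor `2^{k(ω)}` is
absorbed exactly, with no division by `1 − p`. -/
theorem rcWeight_two_div_card_evenSubgraphs {ω : Finset (Sym2 V)}
    (hEC : #(evenSubgraphs G (↑ω : Set (Sym2 V))) * 2 ^ Fintype.card V =
      2 ^ (#ω + clusterCount (↑ω : Set (Sym2 V)) (∅ : Set V))) (p : ℝ) :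
    rcWeight G p 2 ∅ ω / (#(evenSubgraphs G (↑ω : Set (Sym2 V))) : ℝ) =
      2 ^ Fintype.card V * ((p / 2) ^ #ω * (1 - p) ^ #(G.edgeFinset \ ω)) := by
  have hN : (#(evenSubgraphs G (↑ω : Set (Sym2 V))) : ℝ) * 2 ^ Fintype.card V =
      2 ^ #ω * 2 ^ clusterCount (↑ω : Set (Sym2 V)) (∅ : Set V) := by
    rw [← pow_add]
    exact_mod_cast hEC
  have hN0 : (#(evenSubgraphs G (↑ω : Set (Sym2 V))) : ℝ) ≠ 0 := by
    intro h
    rw [h, zero_mul] at hN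
    exact absurd hN (by positivity)
  have h2 : (2 : ℝ) ^ #ω ≠ 0 := by positivity
  rw [div_eq_iff hN0, rcWeight]
  calc p ^ #ω * (1 - p) ^ #(G.edgeFinset \ ω) * 2 ^ clusterCount (↑ω : Set (Sym2 V)) (∅ : Set V)
      = (p / 2) ^ #ω * (1 - p) ^ #(G.edgeFinset \ ω) *
          (2 ^ #ω * 2 ^ clusterCount (↑ω : Set (Sym2 V)) (∅ : Set V)) := by
        rw [div_pow]
        field_simp
    _ = 2 ^ Fintype.card V * ((p / 2) ^ #ω * (1 - p) ^ #(G.edgeFinset \ ω)) *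
          (#(evenSubgraphs G (↑ω : Set (Sym2 V))) : ℝ) := by
        rw [← hN]
        ring

/-- **The sourced Grimmett–Janson identity on one finite graph** [cite: GrimmettJanson2007, Thm 3.1]
(Hansen–Jiang–Klausen 2025, §2 for general sources `A`): given the cycle-space count
`#𝓔_∅(ω) · 2^{|V|} = 2^{|ω| + k(ω)}` for every `ω ⊆ E(G)`, for `p ∈ [0, 1]`, every source set `A`
and every predicate `P`,
`∑_{ω ⊆ E} w_{p,2}(ω) · #{F ∈ 𝒯_A(ω) : P F} / #𝓔_∅(ω)`
`  = 2^{|V|} (1 − p/2)^{|E|} ∑_{F ∈ 𝒯_A(E), P F} (p/(2 − p))^{|F|}`.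
Steps: (1) `filter_tJoins_coe`, (2) `rcWeight_two_div_card_evenSubgraphs`, (3) `Finset.sum_comm'`
and `sum_superset_pow_mul_pow` with `a = p/2`, `b = 1 − p`, (4) `p/(2 − p) = (p/2)/(1 − p/2)`. -/
theorem grimmettJanson_identity
    (hEC : ∀ ω : Finset (Sym2 V), ω ⊆ G.edgeFinset →
      #(evenSubgraphs G (↑ω : Set (Sym2 V))) * 2 ^ Fintype.card V =
        2 ^ (#ω + clusterCount (↑ω : Set (Sym2 V)) (∅ : Set V)))
    {p : ℝ} (hp : p ∈ Set.Icc (0 : ℝ) 1) (A : Finset V) (P : Finset (Sym2 V) → Prop) :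
    ∑ ω ∈ G.edgeFinset.powerset,
        rcWeight G p 2 ∅ ω *
          ((#((tJoins G (↑ω : Set (Sym2 V)) A).filter (fun F => P F)) : ℝ) /
            (#(evenSubgraphs G (↑ω : Set (Sym2 V))) : ℝ)) =
      2 ^ Fintype.card V * (1 - p / 2) ^ #G.edgeFinset *
        ∑ F ∈ (tJoins G Set.univ A).filter (fun F => P F), (p / (2 - p)) ^ #F := by
  -- (1) + (2): pointwise form of the summand
  have step1 : ∀ ω ∈ G.edgeFinset.powerset,
      rcWeight G p 2 ∅ ω *
          ((#((tJoins G (↑ω : Set (Sym2 V)) A).filter (fun F => P F)) : ℝ) /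
            (#(evenSubgraphs G (↑ω : Set (Sym2 V))) : ℝ)) =
        2 ^ Fintype.card V *
          ∑ _F ∈ ((tJoins G Set.univ A).filter (fun F => P F)).filter (fun F => F ⊆ ω),
            (p / 2) ^ #ω * (1 - p) ^ #(G.edgeFinset \ ω) := by
    intro ω hω
    rw [mul_div_left_comm, rcWeight_two_div_card_evenSubgraphs G (hEC ω (mem_powerset.1 hω)),
      filter_tJoins_coe G ω A P, sum_const, nsmul_eq_mul]
    ring
  -- (3a): swap the sums
  have hswap :
      ∑ ω ∈ G.edgeFinset.powerset,
          ∑ _F ∈ ((tJoins G Set.univ A).filter (fun F => P F)).filter (fun F => F ⊆ ω),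
            (p / 2) ^ #ω * (1 - p) ^ #(G.edgeFinset \ ω) =
        ∑ F ∈ (tJoins G Set.univ A).filter (fun F => P F),
          ∑ ω ∈ G.edgeFinset.powerset.filter (fun ω => F ⊆ ω),
            (p / 2) ^ #ω * (1 - p) ^ #(G.edgeFinset \ ω) :=
    Finset.sum_comm' fun ω F => by
      simp only [Finset.mem_filter]
      tauto
  rw [Finset.sum_congr rfl step1, ← Finset.mul_sum, hswap, mul_assoc]
  congr 1
  rw [Finset.mul_sum]
  refine Finset.sum_congr rfl fun F hF => ?_
  -- (3b) + (4): resum over the supersets of `F` and normalise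
  have hFE : F ⊆ G.edgeFinset := ((mem_tJoins G).1 (Finset.mem_filter.1 hF).1).1
  have hle : #F ≤ #G.edgeFinset := card_le_card hFE
  have hc : (1 : ℝ) - p / 2 ≠ 0 := by
    have := hp.2
    intro h
    linarith
  have ht : p / (2 - p) = p / 2 / (1 - p / 2) := by
    rw [show (1 : ℝ) - p / 2 = (2 - p) / 2 by ring, div_div_div_cancel_right₀ two_ne_zero]
  rw [sum_superset_pow_mul_pow hFE, show p / 2 + (1 - p) = 1 - p / 2 by ring, pow_sub₀ _ hc hle,
    ht, div_pow (p / 2), div_eq_mul_inv]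
  ring

end General

/-- STUB `stub_grimmettJanson` of the skeleton `Lines/plaquette-xor-surgery.lean` (crux
`ParityRobustMerging`, stmt-CriticalPhenomena-11253), verbatim: the cycle-space count
`#𝓔_∅(ω) · 2^{|V|} = 2^{|ω| + k(ω)}` (neighbouring stub `stub_evenSubgraphCount`, the antecedent)
implies the sourced Grimmett–Janson identity
`∑_ω w_{p,2}(ω) · #{F ∈ 𝒯_A(ω) : P F}/#𝓔_∅(ω)`
`  = 2^{|V|} (1 − p/2)^{|E|} · ∑_{F ∈ 𝒯_A(G), P F} (p/(2−p))^{|F|}`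
for every finite graph, every `p ∈ [0,1]`, every source set `A` and every predicate `P`
(`grimmettJanson_identity` graph by graph) [cite: GrimmettJanson2007, Thm 3.1]. -/
theorem stub_grimmettJanson :
    (∀ (V : Type) [Fintype V] [DecidableEq V] (G : SimpleGraph V) [DecidableRel G.Adj]
      (ω : Finset (Sym2 V)), ω ⊆ G.edgeFinset →
        #(evenSubgraphs G (↑ω : Set (Sym2 V))) * 2 ^ Fintype.card V =
          2 ^ (#ω + clusterCount (↑ω : Set (Sym2 V)) (∅ : Set V))) →
    ∀ (V : Type) [Fintype V] [DecidableEq V] (G : SimpleGraph V) [DecidableRel G.Adj] (p : ℝ),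
      p ∈ Set.Icc (0 : ℝ) 1 → ∀ (A : Finset V) (P : Finset (Sym2 V) → Prop),
        ∑ ω ∈ G.edgeFinset.powerset,
            rcWeight G p 2 ∅ ω *
              ((#((tJoins G (↑ω : Set (Sym2 V)) A).filter (fun F => P F)) : ℝ) /
                (#(evenSubgraphs G (↑ω : Set (Sym2 V))) : ℝ)) =
          2 ^ Fintype.card V * (1 - p / 2) ^ #G.edgeFinset *
            ∑ F ∈ (tJoins G Set.univ A).filter (fun F => P F), (p / (2 - p)) ^ #F := by
  intro hEC V _ _ G _ p hp A P
  exact grimmettJanson_identity G (fun ω hω => hEC V G ω hω) hp A P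

end Summit.CriticalPhenomena.Ising3DConformalLimit.Cruxes.ParityRobustMerging.PlaquetteXorSurgery

end
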